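import Summits.BirchSwinnertonDyer.BirchSwinnertonDyer.Theorems.GoldfeldAllTwistsTwoConverseTwinAdditiveShaAn
import Literature.NumberTheory.EllipticCurves.QuadraticTwistJInvariantProofs
import Literature.NumberTheory.EllipticCurves.GlobalMinimalModel
import HarnessLib

set_option linter.dupNamespace false -- `…BirchSwinnertonDyer.BirchSwinnertonDyer…` is the cell's namespace (D-0017)
set_option autoImplicit false

/-!
# Twin″ (item 19140) — line «heegner-halves» v2, parity law P1 on the cell, step P1-b: the RANK-ZERO TWIN in
# cell currency — `Wd ≅ 49a1^{(d·D)}`, **`|Cd.u| = 1`** between the minimal models, and its Tamagawa law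

Leafhand `leafhand-bsd-goldfeldalltwistst-3-g1` (prover, explicit unit, 2026-08-31; director-bsd (719)(3): the keyed
follow-up generation on the PROVABLE sub-target «P1 on the cell» only), `--supports stmt-BirchSwinnertonDyer-19140`
(crux twin″ `BSDTwoCMSevenAdditiveRankOne`, registered skeleton `5ff791a1e67d6e63` = line «heegner-halves» v2).
Theses-free; theorems only; no `sorry`, no definition, no named fact, no instance, no notation. HONEST FRAMING:
elementary bookkeeping of Weierstrass models; it closes NO stub of the line (both `2`-adic halves stay research-open,
the print bundle stays Literature debt); item 19140 is NOT closed; BSD is proved for no curve.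

CONTEXT. The two active halves bound `ord₂ #Ш(W)` against `ord₂ 𝔮` for the `L`-free index quotient
`𝔮 = 8·I²·t_W² / (n·k²·t_K²·c²·w²·q(Wd)·|u|·c_W)` (`P2.cmHeegnerIndexQuotient`) of an admissible Heegner datum of a
curve `W` of the additive `ℚ(√−7)` cell, `Wd = Cd • W^{(d_K)}` a global minimal model of the rank-zero twin and
`u = Cd.u`. Their mod-2 shadow is the parity law P1 (`P2.CMRankOneHeegnerIndexParityAtTwo`: `ord₂ 𝔮` even). The
previous hand landed the number-theoretic core of P1 (`…TwinHeegnerHalvesParityCore`, p798948) and listed the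
model-side steps; THIS FILE is step **P1-b** and the twin half of **P1-c**, in the cell's twist currency
(`C • W = X₀(49)^{(d)}`, `d` squarefree, `d ≢ 1 (mod 4)`; seat c301's `exists_squarefree_twist_of_j_neg3375_of_not_good_two`):
* `exists_smul_eq_cm7_quadraticTwist_mul` — TWIST COMPOSITION: `C' • Wd = X₀(49)^{(d·D)}` with `C'.u = C.u·Cd.u⁻¹`
  (`quadraticTwist_smul`, `quadraticTwist_quadraticTwist`), so the twin lies in the cell family with parameter `d·D`;
* `u_eq_two_or_eq_neg_two_of_smul_eq_cm7_quadraticTwist` — the scaling from ANY global minimal model to `X₀(49)^{(d)}`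
  is `±2` (`X₀(49)^{(4d)}` is globally minimal, `isGloballyMinimal_cellTwist`; uniqueness of the minimal model,
  `isGloballyMinimal_unique_holds`);
* **`abs_u_eq_one_of_twin_minimal` — `|Cd.u| = 1`** whenever `d` and `d·D` are squarefree and `≢ 1 (mod 4)` (on the
  cell `D = d_K ≡ 1 (mod 8)` is coprime to `d`): the factor `|u|` of `𝔮` is a `2`-adic unit;
* `tamagawaProduct_twin_eq`, `padicValNat_two_tamagawaProduct_twin` — the uniform Tamagawa law of seat c301
  (`tamagawaProduct_eq_of_smul_eq_cm7_quadraticTwist`, file V; exponent form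
  `padicValNat_two_tamagawaProduct_of_smul_eq_cm7_quadraticTwist`, file VII) transported to the twin:
  `ord₂ ∏c_p(Wd) = 3 + ι(d·D) + 2σ(d·D)` (and `ord₂ ∏c_p(W) = 3 + ι(d) + 2σ(d)`).
With `ParityCore` (`ι(d) + ι(d·D)` odd) these are all the local units of `ord₂ 𝔮`; the assembly (Cassels–Tate for
`#Ш(Wd)`, `n = 1`, the squares) is the sibling file `…TwinHeegnerHalvesParityCell`.

References: [SilvermanAEC2009] VII.1.3(b), VIII.8.3, X.5 Cor. 5.4; [Kraus1989] Prop. 2; [Silverman1994] IV.9.4,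
Table 4.1.
-/

noncomputable section

open scoped Classical

open WeierstrassCurve Literature.NumberTheory.EllipticCurves

namespace Summit.BirchSwinnertonDyer.BirchSwinnertonDyer.Theorems.GoldfeldGoodTwists

section TwinModel

variable {d D : ℤ}

/-- **Twist composition in cell currency.** If `C • W = X₀(49)^{(d)}` and `Cd • W^{(D)} = Wd`, then
`C' • Wd = X₀(49)^{(d·D)}` for the explicit change of variables `C' = (C.u, D·C.r, 0, 0) · Cd⁻¹`, whose scaling is
`C'.u = C.u · Cd.u⁻¹` (twisting commutes with changes of variables, `quadraticTwist_smul`, and is multiplicative,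
`quadraticTwist_quadraticTwist`). [cite: SilvermanAEC2009, X.5 Cor. 5.4] -/
theorem exists_smul_eq_cm7_quadraticTwist_mul (W : WeierstrassCurve ℚ) (C : VariableChange ℚ)
    (hC : C • W = cm7.quadraticTwist (d : ℚ)) (Wd : WeierstrassCurve ℚ) (Cd : VariableChange ℚ)
    (hWd : Cd • W.quadraticTwist (D : ℚ) = Wd) :
    ∃ C' : VariableChange ℚ, C' • Wd = cm7.quadraticTwist ((d * D : ℤ) : ℚ) ∧ C'.u = C.u * Cd.u⁻¹ := by
  refine ⟨⟨C.u, (D : ℚ) * C.r, 0, 0⟩ * Cd⁻¹, ?_, rfl⟩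
  rw [mul_smul, ← hWd, inv_smul_smul, ← quadraticTwist_smul, hC, quadraticTwist_quadraticTwist, Int.cast_mul]

/-- **The scaling from a minimal model to the cell's twist model is `±2`.** For `d` squarefree with
`d ≢ 1 (mod 4)` and a globally minimal `W` with `C • W = X₀(49)^{(d)}`: `C.u = ±2`. Indeed
`(½, 0, 0, 0) • X₀(49)^{(d)} = X₀(49)^{(4d)}` is globally minimal (`isGloballyMinimal_cellTwist`) and two global
minimal models differ by `u = ±1` (`isGloballyMinimal_unique_holds`). [cite: SilvermanAEC2009, VII.1.3(b) and VIII.8.3]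
[cite: Kraus1989, Prop. 2] -/
theorem u_eq_two_or_eq_neg_two_of_smul_eq_cm7_quadraticTwist (hsq : Squarefree d) (hd4 : d % 4 ≠ 1)
    (W : WeierstrassCurve ℚ) [W.IsElliptic] [W.IsGloballyMinimal] (C : VariableChange ℚ)
    (hC : C • W = cm7.quadraticTwist (d : ℚ)) : (C.u : ℚ) = 2 ∨ (C.u : ℚ) = -2 := by
  haveI := isGloballyMinimal_cellTwist hsq hd4
  have h4d : ((4 * d : ℤ) : ℚ) = (2 : ℚ) ^ 2 * (d : ℚ) := by push_cast; ring
  have hmin : ((⟨(Units.mk0 (2 : ℚ) two_ne_zero)⁻¹, 0, 0, 0⟩ : VariableChange ℚ) * C) • W =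
      cm7.quadraticTwist ((4 * d : ℤ) : ℚ) := by
    rw [mul_smul, hC, h4d, cm7.quadraticTwist_sq_mul two_ne_zero]
  haveI : (((⟨(Units.mk0 (2 : ℚ) two_ne_zero)⁻¹, 0, 0, 0⟩ : VariableChange ℚ) * C) • W).IsGloballyMinimal := by
    rw [hmin]; infer_instance
  have hu := (isGloballyMinimal_unique_holds W
    ((⟨(Units.mk0 (2 : ℚ) two_ne_zero)⁻¹, 0, 0, 0⟩ : VariableChange ℚ) * C)).1
  have hval : ((((⟨(Units.mk0 (2 : ℚ) two_ne_zero)⁻¹, 0, 0, 0⟩ : VariableChange ℚ) * C).u : ℚˣ) : ℚ) =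
      2⁻¹ * (C.u : ℚ) := by
    rw [VariableChange.mul_def]
    simp
  rcases hu with h | h
  · left
    have h' := congrArg (fun x : ℚˣ => (x : ℚ)) h
    simp only [hval, Units.val_one] at h'
    linarith
  · right
    have h' := congrArg (fun x : ℚˣ => (x : ℚ)) h
    simp only [hval, Units.val_neg, Units.val_one] at h'
    linarith

/-- `|C.u| = 2` for the scaling of `u_eq_two_or_eq_neg_two_of_smul_eq_cm7_quadraticTwist`.
[cite: SilvermanAEC2009, VII.1.3(b) and VIII.8.3] -/
theorem abs_u_eq_two_of_smul_eq_cm7_quadraticTwist (hsq : Squarefree d) (hd4 : d % 4 ≠ 1)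
    (W : WeierstrassCurve ℚ) [W.IsElliptic] [W.IsGloballyMinimal] (C : VariableChange ℚ)
    (hC : C • W = cm7.quadraticTwist (d : ℚ)) : |(C.u : ℚ)| = 2 := by
  rcases u_eq_two_or_eq_neg_two_of_smul_eq_cm7_quadraticTwist hsq hd4 W C hC with h | h <;>
    rw [h] <;> norm_num

/-- **P1-b: `|Cd.u| = 1` BETWEEN THE MINIMAL MODELS OF THE TWIN PAIR.** Let `d` and `d·D` be squarefree
with `d, d·D ≢ 1 (mod 4)` (on the cell: `D = d_K ≡ 1 (mod 8)` coprime to `d`), `W` a globally minimal model of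
`X₀(49)^{(d)}` (`C • W = X₀(49)^{(d)}`) and `Wd` a globally minimal model of the twist `W^{(D)}`
(`Cd • W^{(D)} = Wd`). Then `|Cd.u| = 1`: both scalings `W → X₀(49)^{(d)}` and `Wd → X₀(49)^{(d·D)}` are `±2`
and the second is `C.u · Cd.u⁻¹`. This is the factor `|u|` of the `L`-free index quotient `𝔮`
(`P2.cmHeegnerIndexQuotient`): `ord₂ |u| = 0` on the cell. [cite: SilvermanAEC2009, VII.1.3(b) and VIII.8.3]
[cite: Kraus1989, Prop. 2] -/
theorem abs_u_eq_one_of_twin_minimal (hsq : Squarefree d) (hd4 : d % 4 ≠ 1)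
    (hsqD : Squarefree (d * D)) (hdD4 : (d * D) % 4 ≠ 1)
    (W : WeierstrassCurve ℚ) [W.IsElliptic] [W.IsGloballyMinimal] (C : VariableChange ℚ)
    (hC : C • W = cm7.quadraticTwist (d : ℚ))
    (Wd : WeierstrassCurve ℚ) [Wd.IsElliptic] [Wd.IsGloballyMinimal] (Cd : VariableChange ℚ)
    (hWd : Cd • W.quadraticTwist (D : ℚ) = Wd) : |(Cd.u : ℚ)| = 1 := by
  obtain ⟨C', hC', hu'⟩ := exists_smul_eq_cm7_quadraticTwist_mul W C hC Wd Cd hWd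
  have h1 := abs_u_eq_two_of_smul_eq_cm7_quadraticTwist hsq hd4 W C hC
  have h2 := abs_u_eq_two_of_smul_eq_cm7_quadraticTwist hsqD hdD4 Wd C' hC'
  rw [hu', Units.val_mul, Units.val_inv_eq_inv_val, abs_mul, abs_inv, h1] at h2
  have hne : |(Cd.u : ℚ)| ≠ 0 := abs_ne_zero.mpr Cd.u.ne_zero
  field_simp at h2
  linarith

/-- **The twin's Tamagawa product.** With `d·D` squarefree, `d·D ≢ 1 (mod 4)`, `7 ∤ d·D`: every model `Wd` of the
twist `W^{(D)}` of a model `W` of `X₀(49)^{(d)}` has `∏_p c_p(Wd) = 8 · ∏_{ℓ ∣ dD, ℓ odd} (2 if (ℓ/7) = −1 else 4)` —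
seat c301's uniform Tamagawa law `tamagawaProduct_eq_of_smul_eq_cm7_quadraticTwist` at the parameter `d·D`.
[cite: Silverman1994, IV.9.4 and Table 4.1] -/
theorem tamagawaProduct_twin_eq (hsqD : Squarefree (d * D)) (hdD4 : (d * D) % 4 ≠ 1)
    (h7 : ¬ (7 : ℤ) ∣ d * D) (W : WeierstrassCurve ℚ) (C : VariableChange ℚ)
    (hC : C • W = cm7.quadraticTwist (d : ℚ))
    (Wd : WeierstrassCurve ℚ) [Wd.IsElliptic] (Cd : VariableChange ℚ)
    (hWd : Cd • W.quadraticTwist (D : ℚ) = Wd) :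
    Wd.tamagawaProduct =
      8 * ∏ l ∈ ((d * D).natAbs.primeFactors.erase 2), (if jacobiSym l 7 = -1 then 2 else 4) := by
  obtain ⟨C', hC', -⟩ := exists_smul_eq_cm7_quadraticTwist_mul W C hC Wd Cd hWd
  exact tamagawaProduct_eq_of_smul_eq_cm7_quadraticTwist hsqD hdD4 h7 Wd C' hC'

/-- **`ord₂ ∏_p c_p(Wd) = 3 + ι(d·D) + 2σ(d·D)` for the twin** (`d·D` squarefree, `≢ 1 (mod 4)`, `7 ∤ d·D`).
[cite: Silverman1994, IV.9.4 and Table 4.1] -/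
theorem padicValNat_two_tamagawaProduct_twin (hsqD : Squarefree (d * D)) (hdD4 : (d * D) % 4 ≠ 1)
    (h7 : ¬ (7 : ℤ) ∣ d * D) (W : WeierstrassCurve ℚ) (C : VariableChange ℚ)
    (hC : C • W = cm7.quadraticTwist (d : ℚ))
    (Wd : WeierstrassCurve ℚ) [Wd.IsElliptic] (Cd : VariableChange ℚ)
    (hWd : Cd • W.quadraticTwist (D : ℚ) = Wd) :
    padicValNat 2 Wd.tamagawaProduct =
      3 + (((d * D).natAbs.primeFactors.erase 2).filter (fun l : ℕ => jacobiSym l 7 = -1)).card +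
        2 * (((d * D).natAbs.primeFactors.erase 2).filter (fun l : ℕ => ¬ jacobiSym l 7 = -1)).card := by
  obtain ⟨C', hC', -⟩ := exists_smul_eq_cm7_quadraticTwist_mul W C hC Wd Cd hWd
  exact padicValNat_two_tamagawaProduct_of_smul_eq_cm7_quadraticTwist hsqD hdD4 h7 Wd C'
    (by rw [hC', Int.cast_mul])

end TwinModel

end Summit.BirchSwinnertonDyer.BirchSwinnertonDyer.Theorems.GoldfeldGoodTwists

end
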